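import Summits.QuantumFields.YangMills.Theorems.BalabanUVNodesPortHRecordJoinDefs
import Summits.QuantumFields.YangMills.Theorems.BalabanUVNodesK0RecordFormatNamesLemmas10
import Summits.QuantumFields.YangMills.Theorems.BalabanUVNodesPortS1Selector

/-!
# PORT helper (PT-H ∕ K0ᴬ JOIN lineage; ORDER O-3 (b)) — THE DRESSED CHART's LOCAL SWAP ROW DERIVED: `SwapRowAtL F θ Mc k K` ⟸ the construction of DEF-1's
# `recordEmbL` + the texts' own TokP9-reg antecedent (`P9RegAt`) + the standing range `k + 1 ≤ m + K`; witness `g := recordDress B`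

AUTHORSHIP ∕ CREDIT.  The mathematics and the Lean text below are ◇ LENS-1's (planner seat `ymgap-nodeO-lens-1` g4–g5), HOME file of record
`pub/ym-nodeO-ideate/nodeO-cover/LENS-1-Slot8RecordJoin-v5.2.lean` (sha16 01e44366c253a20c · 1 783 l. · 91 thm · 19 def; farm rc 0 · 0 warn · 0 sorry; §-numbers below are
that file's), landed for the tree by porter PTC-1 g3 (`ymgap-nodeO-port-PTC-1`) under port-lead ORDER O-3 (b) (nodeO STATUS 2026-08-31T01:44:50Z ∕ 02:17:04Z ∕ 02:23:59Z),
keyed `--supports stmt-QuantumFields-27238 --as helper` (K0ᴬ `Record13SepCoPHInhabitedAx`; no `--workitem`, R615).  Deviations from the HOME bytes: the namespace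
(`…Theorems.PortHRecordJoin`), the split into ≤ 400-line files (`…PortHRecordJoinDefs` ∕ `…Rows` ∕ `…Swap` ∕ `…Join` + `…PortHIotaRowAtL`), tree receipts cited BY NAME
instead of displayed hypotheses, the family binder `F` made explicit on `Sig8LR4 ∕ Sig7L9 ∕ JoinGoalL`, and NO import of the route file `Theses.BalabanUVNodes` anywhere (port-lead docket
O-8: the JOIN is keyed to LOCAL verbatim copies of the two signed texts, so a re-key of a route decl cannot break it).  [I] = [Balaban1987RG1], [15] = [Balaban1985Variational].

THIS FILE (JOIN §14, eleven lemmas, all lens-1's): on a bond `b ∈ X` the dressed chart writes `exp (π log 𝐔_L(b)) = 𝐔_L(b)` (`det 𝐔_L(b) = 1` and `‖𝐔_L(b) − 1‖ ≤ ½`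
eventually ⟹ `tr log = 0`) and `π 𝐉_L(b) = 𝐉_L(b)` (`tr (u J u⁻¹) = tr J = 0`), i.e. exactly `(𝐔, 𝐉)^{u_B}` cut to `X` = `recordAct u_B` of the rooted chart's decoded pair on
the coordinates of `X`: `chartMatU_recordEmbL`, `trace_recordPairL_snd`, `chartMatJc_recordEmbL_eq`, `det_recordPairL_fst`, `trace_mlog_eq_zero_of_det_eq_one` (PT-S1's
`trace_mlog_eq_zero_of_SU2` with the determinant hypothesis abstracted; the tree's `ExpMeanLog.trace_mlog_eq_zero_of_det_eq_one` wants `≤ ⅓`), `exp_chartMatU_recordEmbL`,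
`decodeCfg_recordChartJ_recordEmbL`, ★ `recordChartJ_recordEmbL_eq_act` (the swap identity on `recordCoords X`, pointwise in `B`), `continuous_recordPhi ∕
continuous_recordDress_val ∕ _inv`, `eventually_norm_recordPairL_fst_sub_one_le`, ★★ `swapRowAtL_of_p9RegAt : k + 1 ≤ m + K → P9RegAt F θ k K → SwapRowAtL F θ Mc k K`.
Tree inputs BY NAME: PT-S1's `sum_sl2Coord_smul_sl2Gen ∕ trace_recordCurrent ∕ norm_trace_le_two_mul ∕ decodeCfg_recordChartJ_recordEmbJ ∕ continuousAt_recordBgField_of_analyticAt ∕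
eventually_norm_recordBgField_sub_one_le ∕ recordBgField_zero` (✓`…PortS1Selector` and its imports), DEF-1's `recordPairL_zero` (Lemmas10), port-M's `MatrixLog.exp_mlog ∕
norm_mlog_le_log_two`, `Literature.Analysis.Matrix.det_exp_eq_exp_trace`.

HONEST FRAMING.  Bookkeeping ∕ calculus ∕ generic implications over DISPLAYED rows; every displayed row of the JOIN is the consequent of an OPEN signed statement item
(27930 ⁸ `PortRecordRepresentationS1` 12934e3fd231d69a; 27931 ⁷‴ `PortPieceLocalityU8` v9-L ce176c419bf63055) or a tree receipt; TokP9-reg ([15] Thm 1 + Prop. 9 AT THE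
RECORD) is the texts' own antecedent and is NOT proved; nothing of [I] (Thm 1, (1.19)–(1.22), (4.33)–(4.37), (5.10)) or [15] (Thm 1, Prop. 9, (190)) is asserted, ported,
discharged or refuted; K-Ax 27238∕27239∕27247 OPEN; K0⁷∕K0ᴬ OPEN; NODE O 0∕1; COUNT 8∕28 · K 1∕4 UNMOVED; ONE finite `𝕋⁴_{L^K}` at fixed ε — NOT continuum ∕ OS ∕ Clay;
**the Yang–Mills mass gap (Clay) is NOT proved by any of this.**  No `sorry`, no `instance`, no `notation`; standard axioms.
-/

noncomputable section

open scoped BigOperators Matrix.Norms.L2Operator Topology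
open Set Filter

namespace Summit.QuantumFields.YangMills.Theorems.PortHRecordJoin

open Summit.QuantumFields.YangMills.Theorems.K0RecordFormatNames
open Summit.QuantumFields.YangMills.Theorems
open Literature.MathematicalPhysics.QuantumFieldTheory.Balaban1983to89
open Literature.MathematicalPhysics.QuantumFieldTheory.Balaban1983to89.Node00
open Literature.MathematicalPhysics.QuantumFieldTheory.Balaban1983to89.T4Continuum (T4Family)
open NormedSpace (exp)

variable {F : T4Family}

/-! ## §14  (v4.1, g5) THE SWAP ROW DERIVED: `SwapRowAtL` ⟸ the construction of `recordEmbL` + the texts' own TokP9-reg antecedent (+ the standing range `k + 1 ≤ m + K`,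
automatic on the runs' tori).  Witness `g := recordDress B`.  Mechanism: on a bond `b ∈ X` the dressed chart writes `exp (π log 𝐔_L(b)) = 𝐔_L(b)` (`det 𝐔_L(b) = 1` and
`‖𝐔_L(b) − 1‖ ≤ ½` eventually ⟹ `tr log = 0`) and `π 𝐉_L(b) = 𝐉_L(b)` (`tr (u J u⁻¹) = tr J = 0`), i.e. exactly `(𝐔, 𝐉)^{u_B}` cut to `X` = `recordAct u_B` of the rooted
chart's decoded pair on the coordinates of `X`. -/

section PorterL
variable (F) (θ : Stage13Params F 2)

/-- `chartMatU ∘ recordEmbL` is the series logarithm of the DRESSED `𝐔`-block up to its trace part. [cite: Balaban1987RG1, p.258, (1.9) p.261, (4.2) p.281] -/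
theorem chartMatU_recordEmbL (k K : ℕ) (B : Fin (F.P K).d → Site (F.P K) (k + 1) → θ.Vβ) (b : PBond (F.P K) 0) :
    chartMatU F K (recordEmbL F θ k K B) b =
      MatrixLog.mlog ((recordPairL F θ k K B).1 b) - ((MatrixLog.mlog ((recordPairL F θ k K B).1 b)).trace / 2) • (1 : MatA 2) := by
  have h : chartMatU F K (recordEmbL F θ k K B) b = ∑ a : Fin 3, sl2Coord (MatrixLog.mlog ((recordPairL F θ k K B).1 b)) a • sl2Gen a := by
    simp only [chartMatU, recordEmbL, Equiv.symm_apply_apply, Sum.elim_inl]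
  rw [h]
  exact BalabanUVNodesPortS1.sum_sl2Coord_smul_sl2Gen _

/-- The DRESSED `𝐉`-block `u J u⁻¹` is traceless (the current is). [cite: Balaban1987RG1, (1.8) p.261, (1.10) p.262] -/
theorem trace_recordPairL_snd (k K : ℕ) (B : Fin (F.P K).d → Site (F.P K) (k + 1) → θ.Vβ) (b : PBond (F.P K) 0) :
    ((recordPairL F θ k K B).2 b).trace = 0 := by
  show ((((recordDress F θ k K B).1 b.src : (MatA 2)ˣ) : MatA 2) * recordCurrent F θ k K B b *
      ((((recordDress F θ k K B).1 b.src)⁻¹ : (MatA 2)ˣ) : MatA 2)).trace = 0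
  rw [Matrix.trace_mul_cycle, Units.inv_mul, one_mul]
  exact BalabanUVNodesPortS1.trace_recordCurrent F θ k K B b

/-- `chartMatJc ∘ recordEmbL` IS the dressed `𝐉`-block. [cite: Balaban1987RG1, (1.8)–(1.9) p.261, (1.10) p.262] -/
theorem chartMatJc_recordEmbL_eq (k K : ℕ) (B : Fin (F.P K).d → Site (F.P K) (k + 1) → θ.Vβ) (b : PBond (F.P K) 0) :
    chartMatJc F K (recordEmbL F θ k K B) b = (recordPairL F θ k K B).2 b := by
  have h : chartMatJc F K (recordEmbL F θ k K B) b = ∑ a : Fin 3, sl2Coord ((recordPairL F θ k K B).2 b) a • sl2Gen a := by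
    simp only [chartMatJc, recordEmbL, Equiv.symm_apply_apply, Sum.elim_inr]
  rw [h, BalabanUVNodesPortS1.sum_sl2Coord_smul_sl2Gen, trace_recordPairL_snd, zero_div, zero_smul, sub_zero]

/-- The DRESSED `𝐔`-block `u₋ U u₊⁻¹` has determinant `1` (`u ∈ SL(2,ℂ)`-valued, `U ∈ SU(2)`). [cite: Balaban1987RG1, (1.10) p.262, p.252] -/
theorem det_recordPairL_fst (k K : ℕ) (B : Fin (F.P K).d → Site (F.P K) (k + 1) → θ.Vβ) (b : PBond (F.P K) 0) :
    ((recordPairL F θ k K B).1 b).det = 1 := by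
  have hu : ∀ x, Matrix.det (((recordDress F θ k K B).1 x : (MatA 2)ˣ) : MatA 2) = 1 := fun x =>
    B12RegularSpaces111SpecialUnitary.mem_suModel_Gc.mp ((recordDress F θ k K B).2 x)
  have hui : ∀ x, Matrix.det ((((recordDress F θ k K B).1 x)⁻¹ : (MatA 2)ˣ) : MatA 2) = 1 := fun x => by
    have h := congrArg Matrix.det (((recordDress F θ k K B).1 x).mul_inv)
    rw [Matrix.det_mul, hu x, one_mul, Matrix.det_one] at h
    exact h
  have hU : Matrix.det ((recordBgField F θ k K B b : SU 2) : MatA 2) = 1 :=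
    (Matrix.mem_specialUnitaryGroup_iff.mp (recordBgField F θ k K B b).2).2
  show Matrix.det ((((recordDress F θ k K B).1 b.src : (MatA 2)ˣ) : MatA 2) * ((recordBgField F θ k K B b : SU 2) : MatA 2) *
      ((((recordDress F θ k K B).1 b.tgt)⁻¹ : (MatA 2)ˣ) : MatA 2)) = 1
  rw [Matrix.det_mul, Matrix.det_mul, hu, hU, hui, mul_one, mul_one]

/-- **`tr log W = 0` for `det W = 1`, `‖W − 1‖ ≤ ½`** (the series logarithm; `exp tr log W = det W = 1` and `|tr log W| ≤ 2 log 2 < 2π`) — PT-S1's `trace_mlog_eq_zero_of_SU2` with the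
determinant hypothesis abstracted (same proof). [cite: Hall2015, Thm 2.8, Prop. 2.3; Balaban1987RG1, p.258] -/
theorem trace_mlog_eq_zero_of_det_eq_one (W : MatA 2) (hW : ‖W - 1‖ ≤ 1 / 2) (hdet : W.det = 1) : (MatrixLog.mlog W).trace = 0 := by
  set A : MatA 2 := MatrixLog.mlog W with hAdef
  have hW1 : ‖W - 1‖ < 1 := by linarith
  have hexp : exp A = W := MatrixLog.exp_mlog hW1
  have htr : exp A.trace = (1 : ℂ) := by
    have h := Literature.Analysis.Matrix.det_exp_eq_exp_trace A
    rw [hexp, hdet] at h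
    exact h.symm
  have htrC : Complex.exp A.trace = 1 := by
    rw [Complex.exp_eq_exp_ℂ]; exact htr
  obtain ⟨n, hn⟩ := Complex.exp_eq_one_iff.mp htrC
  have hAn : ‖A‖ ≤ Real.log 2 := MatrixLog.norm_mlog_le_log_two hW
  have hlt : ‖A.trace‖ < 2 * Real.pi := by
    have hlog : Real.log 2 < 1 := by
      have := Real.log_two_lt_d9; linarith
    calc ‖A.trace‖ ≤ 2 * ‖A‖ := BalabanUVNodesPortS1.norm_trace_le_two_mul A
      _ ≤ 2 * Real.log 2 := by linarith
      _ < 2 * Real.pi := by nlinarith [Real.pi_gt_three]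
  have hn0 : n = 0 := by
    by_contra h
    have h1 : (1 : ℝ) ≤ |(n : ℝ)| := by exact_mod_cast Int.one_le_abs h
    rw [hn] at hlt
    have hnorm : ‖(n : ℂ) * (2 * Real.pi * Complex.I)‖ = |(n : ℝ)| * (2 * Real.pi) := by
      rw [norm_mul, Complex.norm_intCast, norm_mul, Complex.norm_I, mul_one, norm_mul, Complex.norm_ofNat,
        Complex.norm_real, Real.norm_of_nonneg Real.pi_pos.le]
    rw [hnorm] at hlt
    nlinarith [Real.pi_pos]
  rw [hn, hn0]
  simp

/-- **THE DRESSED CHART ROUND TRIP**: `exp (chartMatU (recordEmbL B) b) = 𝐔_L(b)` where the dressed `𝐔`-block is within `½` of the unit. [cite: Balaban1987RG1, p.258, (1.9) p.261, (4.2) p.281] -/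
theorem exp_chartMatU_recordEmbL (k K : ℕ) (B : Fin (F.P K).d → Site (F.P K) (k + 1) → θ.Vβ) (b : PBond (F.P K) 0)
    (hW : ‖(recordPairL F θ k K B).1 b - 1‖ ≤ 1 / 2) :
    exp (chartMatU F K (recordEmbL F θ k K B) b) = (recordPairL F θ k K B).1 b := by
  rw [chartMatU_recordEmbL, trace_mlog_eq_zero_of_det_eq_one _ hW (det_recordPairL_fst F θ k K B b), zero_div, zero_smul, sub_zero]
  exact MatrixLog.exp_mlog (by linarith)

open scoped Classical in
/-- **WHAT THE DRESSED CHART∘EMBEDDING FEEDS THE PIECES = THE DRESSED (1.9) PAIR CUT TO `X`** (where the dressed `𝐔`-block is within `½` of the unit on the bonds of `X`).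
[cite: Balaban1987RG1, (1.7), (1.8)–(1.9) p.261, (4.2) p.281] -/
theorem decodeCfg_recordChartJ_recordEmbL (Mc k K : ℕ) (X : (recordDomSys F Mc k K).Dom) (B : Fin (F.P K).d → Site (F.P K) (k + 1) → θ.Vβ)
    (hW : ∀ b ∈ domBonds F Mc k K X, ‖(recordPairL F θ k K B).1 b - 1‖ ≤ 1 / 2) :
    decodeCfg F K (recordChartJ F Mc k K X (recordEmbL F θ k K B)) =
      (fun b => if b ∈ domBonds F Mc k K X then (recordPairL F θ k K B).1 b else 1,
       fun b => if b ∈ domBonds F Mc k K X then (recordPairL F θ k K B).2 b else 0) := by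
  classical
  have hdec : decodeCfg F K (recordChartJ F Mc k K X (recordEmbL F θ k K B)) =
      (fun b => if b ∈ domBonds F Mc k K X then exp (chartMatU F K (recordEmbL F θ k K B) b) else 1,
       fun b => if b ∈ domBonds F Mc k K X then chartMatJc F K (recordEmbL F θ k K B) b else 0) := by
    simp [recordChartJ]
  rw [hdec, Prod.mk.injEq]
  refine ⟨funext fun b => ?_, funext fun b => ?_⟩
  · by_cases hb : b ∈ domBonds F Mc k K X
    · rw [if_pos hb, if_pos hb, exp_chartMatU_recordEmbL F θ k K B b (hW b hb)]
    · rw [if_neg hb, if_neg hb]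
  · by_cases hb : b ∈ domBonds F Mc k K X
    · rw [if_pos hb, if_pos hb, chartMatJc_recordEmbL_eq]
    · rw [if_neg hb, if_neg hb]

open scoped Classical in
/-- **THE SWAP IDENTITY ON THE COORDINATES OF `X`** (pointwise in `B`, where both the rooted and the dressed `𝐔`-blocks are within `½` of the unit on the bonds of `X`):
`χ_X(ι_L B) = recordAct u_B (χ_X(ι_J B))` on `recordCoords X`. [cite: Balaban1987RG1, (1.7) p.261, (1.10) p.262, (4.2) p.281] -/
theorem recordChartJ_recordEmbL_eq_act (Mc k K : ℕ) (X : (recordDomSys F Mc k K).Dom) (B : Fin (F.P K).d → Site (F.P K) (k + 1) → θ.Vβ)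
    (hU : ∀ b ∈ domBonds F Mc k K X, ‖((recordBgField F θ k K B b : SU 2) : MatA 2) - 1‖ ≤ 1 / 2)
    (hW : ∀ b ∈ domBonds F Mc k K X, ‖(recordPairL F θ k K B).1 b - 1‖ ≤ 1 / 2) :
    ∀ i ∈ recordCoords F Mc k K X,
      recordChartJ F Mc k K X (recordEmbL F θ k K B) i = recordAct F K (recordDress F θ k K B) (recordChartJ F Mc k K X (recordEmbJ F θ k K B)) i := by
  classical
  intro i hi
  have hL : recordChartJ F Mc k K X (recordEmbL F θ k K B) = encodeCfg F K (decodeCfg F K (recordChartJ F Mc k K X (recordEmbL F θ k K B))) :=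
    (encodeCfg_decodeCfg F K _).symm
  rw [hL, decodeCfg_recordChartJ_recordEmbL F θ Mc k K X B hW, recordAct,
    BalabanUVNodesPortS1.decodeCfg_recordChartJ_recordEmbJ F θ Mc k K X B hU]
  obtain ⟨c, rfl⟩ : ∃ c, cfgEquiv F K c = i := ⟨(cfgEquiv F K).symm i, Equiv.apply_symm_apply _ _⟩
  have hc : Sum.elim id id c.1 ∈ domBonds F Mc k K X := by
    simpa [recordCoords] using hi
  rcases c with ⟨b | b, e₁, e₂⟩
  · have hb : b ∈ domBonds F Mc k K X := by simpa using hc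
    simp only [encodeCfg, Equiv.symm_apply_apply, Sum.elim_inl, Sect2.cAct, if_pos hb]
    rfl
  · have hb : b ∈ domBonds F Mc k K X := by simpa using hc
    simp only [encodeCfg, Equiv.symm_apply_apply, Sum.elim_inr, Sect2.cAct, if_pos hb]
    rfl

/-- The traceless (21)-Landau potential in a direction is CONTINUOUS in the direction (ℝ-linear between finite-dimensional spaces: `fderiv` applied, the linear Landau
potential, the linear projection `π`). [cite: Balaban1985Variational, (21) p.281, Prop. 9 p.309 (bookkeeping)] -/
theorem continuous_recordPhi (k K : ℕ) (x : Site (F.P K) 0) :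
    letI := θ.instVβ₁; letI := θ.instVβ₂
    Continuous (fun B : Fin (F.P K).d → Site (F.P K) (k + 1) → θ.Vβ => recordPhi F θ k K B x) := by
  letI := θ.instVβ₁; letI := θ.instVβ₂
  have hD : Continuous (fun B : Fin (F.P K).d → Site (F.P K) (k + 1) → θ.Vβ => recordDdir F θ k K B) := by
    unfold recordDdir
    exact (fderiv ℝ _ 0).continuous
  let Lp : (PBond (F.P K) 0 → ℂ) →ₗ[ℝ] (Site (F.P K) 0 → ℂ) :=
    { toFun := fun y => landauPotC F k K y
      map_add' := fun y y' => landauPotC_add F k K y y'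
      map_smul' := fun t y => by
        have hy : (t • y : PBond (F.P K) 0 → ℂ) = fun b => (t : ℂ) * y b := funext fun b => by simp [Complex.real_smul]
        rw [RingHom.id_apply, hy, landauPotC_smul]
        funext s
        simp [Complex.real_smul] }
  have hLp : Continuous (fun y : PBond (F.P K) 0 → ℂ => landauPotC F k K y) := Lp.continuous_of_finiteDimensional
  have hM : Continuous (fun B : Fin (F.P K).d → Site (F.P K) (k + 1) → θ.Vβ =>
      fun i i' : Fin 2 => landauPotC F k K (fun b => recordDdir F θ k K B b i i') x) := by
    refine continuous_pi fun i => continuous_pi fun i' => ?_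
    have h1 : Continuous (fun B : Fin (F.P K).d → Site (F.P K) (k + 1) → θ.Vβ => fun b => recordDdir F θ k K B b i i') :=
      continuous_pi fun b => (continuous_apply i').comp ((continuous_apply i).comp ((continuous_apply b).comp hD))
    exact (continuous_apply x).comp (hLp.comp h1)
  have hof : Continuous (fun A : Fin 2 → Fin 2 → ℂ => (Matrix.of A : MatA 2)) := continuous_id
  have hP : Continuous (fun A : MatA 2 => sl2Proj A) := LinearMap.continuous_of_finiteDimensional _
  exact hP.comp (hof.comp hM)

/-- The dressing `u_B(x) = exp φ_B(x)` is continuous in the direction. [cite: Balaban1987RG1, (1.10) p.262, (4.2) p.281 (bookkeeping)] -/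
theorem continuous_recordDress_val (k K : ℕ) (x : Site (F.P K) 0) :
    letI := θ.instVβ₁; letI := θ.instVβ₂
    Continuous (fun B : Fin (F.P K).d → Site (F.P K) (k + 1) → θ.Vβ => (((recordDress F θ k K B).1 x : (MatA 2)ˣ) : MatA 2)) := by
  letI := θ.instVβ₁; letI := θ.instVβ₂
  letI : NormedAlgebra ℚ (MatA 2) := NormedAlgebra.restrictScalars ℚ ℂ (MatA 2)
  show Continuous (fun B : Fin (F.P K).d → Site (F.P K) (k + 1) → θ.Vβ => exp (recordPhi F θ k K B x))
  exact NormedSpace.exp_continuous.comp (continuous_recordPhi F θ k K x)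

/-- … and so is its inverse `u_B(x)⁻¹ = exp (−φ_B(x))`. [cite: Balaban1987RG1, (1.10) p.262 (bookkeeping)] -/
theorem continuous_recordDress_inv (k K : ℕ) (x : Site (F.P K) 0) :
    letI := θ.instVβ₁; letI := θ.instVβ₂
    Continuous (fun B : Fin (F.P K).d → Site (F.P K) (k + 1) → θ.Vβ => ((((recordDress F θ k K B).1 x)⁻¹ : (MatA 2)ˣ) : MatA 2)) := by
  letI := θ.instVβ₁; letI := θ.instVβ₂
  letI : NormedAlgebra ℚ (MatA 2) := NormedAlgebra.restrictScalars ℚ ℂ (MatA 2)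
  show Continuous (fun B : Fin (F.P K).d → Site (F.P K) (k + 1) → θ.Vβ => exp (-recordPhi F θ k K B x))
  exact NormedSpace.exp_continuous.comp (continuous_recordPhi F θ k K x).neg

/-- **THE DRESSED `𝐔`-BLOCK IS NEAR THE UNIT, EVENTUALLY** (`k + 1 ≤ m + K`, TokP9-reg shape): `‖𝐔_L(B)(b) − 1‖ ≤ ½` on every fine bond eventually near `B = 0` (continuity of
`u_B`, `U_{k+1}(W_B)`, `u_B⁻¹` at `0`, all `= 1` there). [cite: Balaban1985Variational, Prop. 9 p.309; Balaban1987RG1, (2.3) p.265, (4.2) p.281] -/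
theorem eventually_norm_recordPairL_fst_sub_one_le {k K : ℕ} (hk : k + 1 ≤ (F.P K).m + (F.P K).K) (hP9 : P9RegAt F θ k K) :
    letI := θ.instVβ₁; letI := θ.instVβ₂
    ∀ᶠ B in 𝓝 (0 : Fin (F.P K).d → Site (F.P K) (k + 1) → θ.Vβ), ∀ b : PBond (F.P K) 0, ‖(recordPairL F θ k K B).1 b - 1‖ ≤ 1 / 2 := by
  letI := θ.instVβ₁; letI := θ.instVβ₂
  refine Filter.eventually_all.mpr fun b => ?_
  have hc : ContinuousAt (fun B : Fin (F.P K).d → Site (F.P K) (k + 1) → θ.Vβ => (recordPairL F θ k K B).1 b) 0 := by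
    show ContinuousAt (fun B : Fin (F.P K).d → Site (F.P K) (k + 1) → θ.Vβ =>
      (((recordDress F θ k K B).1 b.src : (MatA 2)ˣ) : MatA 2) * ((recordBgField F θ k K B b : SU 2) : MatA 2) *
        ((((recordDress F θ k K B).1 b.tgt)⁻¹ : (MatA 2)ˣ) : MatA 2)) 0
    exact (((continuous_recordDress_val F θ k K b.src).continuousAt).mul
      (BalabanUVNodesPortS1.continuousAt_recordBgField_of_analyticAt F θ k K hP9 b)).mul
      (continuous_recordDress_inv F θ k K b.tgt).continuousAt
  have h0 : (recordPairL F θ k K (0 : Fin (F.P K).d → Site (F.P K) (k + 1) → θ.Vβ)).1 b = 1 := by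
    rw [recordPairL_zero F θ k K]
    show ((recordBgField F θ k K (0 : Fin (F.P K).d → Site (F.P K) (k + 1) → θ.Vβ) b : SU 2) : MatA 2) = 1
    rw [BalabanUVNodesPortS1.recordBgField_zero F θ hk]
    show (((1 : SU 2)) : MatA 2) = 1
    simp
  have hev := (Metric.tendsto_nhds.mp hc) (1 / 2) (by norm_num)
  filter_upwards [hev] with B hB
  rw [dist_eq_norm, h0] at hB
  exact hB.le

/-- ★★ **(E2′-local) DERIVED — `SwapRowAtL` HOLDS under the texts' TokP9-reg antecedent** (`k + 1 ≤ m + K`): witness `g := recordDress B` (the Landau dressing; not residual, not needed to be —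
⁸'s `GaugeInv119` quantifies every `Gᶜ`-valued `u`). [cite: Balaban1987RG1, (1.10) p.262, (1.19) p.263, (4.2) p.281; Balaban1985Variational, Prop. 9 p.309, (21) p.281] -/
theorem swapRowAtL_of_p9RegAt (Mc : ℕ) {k K : ℕ} (hk : k + 1 ≤ (F.P K).m + (F.P K).K) (hP9 : P9RegAt F θ k K) : SwapRowAtL F θ Mc k K := by
  letI := θ.instVβ₁; letI := θ.instVβ₂
  have hU := BalabanUVNodesPortS1.eventually_norm_recordBgField_sub_one_le F θ hk hP9
  have hW := eventually_norm_recordPairL_fst_sub_one_le F θ hk hP9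
  show ∀ᶠ B in 𝓝 (0 : Fin (F.P K).d → Site (F.P K) (k + 1) → θ.Vβ), ∀ X : (recordDomSys F Mc k K).Dom,
    ∃ g : recordGaugeGrp F K, ∀ i ∈ recordCoords F Mc k K X,
      recordChartJ F Mc k K X (recordEmbL F θ k K B) i = recordAct F K g (recordChartJ F Mc k K X (recordEmbJ F θ k K B)) i
  filter_upwards [hU, hW] with B hBU hBW
  intro X
  exact ⟨recordDress F θ k K B, recordChartJ_recordEmbL_eq_act F θ Mc k K X B (fun b _ => hBU b) (fun b _ => hBW b)⟩

end PorterL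

end Summit.QuantumFields.YangMills.Theorems.PortHRecordJoin

end
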